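import Summits.QuantumFields.YangMills.Theorems.UnitScaleTiltProp7GreenPiGradientRowOfLetters
import Summits.QuantumFields.YangMills.Theorems.UnitScaleTiltProp7H1fNormOfSupLetters
import Summits.QuantumFields.YangMills.Theorems.UnitScaleTiltProp7FrakGSupRowsOfWords
import HarnessLib

/-!
# Route `UnitScaleTilt`, crux K1 «MinimiserStabilityRegPr» (stmt-QuantumFields-19200), EX rows `norm_H₁` ∕ `norm_G` (S47 ✓p766895), ★p1 g27 CENSUS #46 rows (5)(6) —
# **(H1∇)-E2E: THE (115)-GRADIENT HALF OF `norm_H₁` FROM LETTERS** — the N1-H door's `hG` letter (= the 𝔊-door's `hHG`) at the slot `Δ₁ = Pᴾ†(Δ^η + T_J)Pᴾ` is the `DeltaOneP T_J`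
# edition of px21 g15's slot-generic `H = G∘Q_k†∘K⁻¹` gradient composition over this lineage's (∇1)-KNIT ✓p774384; so census row (6)'s «∇-half = DISPLAY» retires modulo the same
# letters as row (5), and the 𝔊-door loses its `hHG`∕`norm_H₁` display in favour of the VALUE row of `H₁` + two K-storey sup rows.

Cell `ym3-torus` (HUMAN RULING D-0037; rung R3 = SU(2) YM₃ on T³ — NOT d = 4, NOT infinite volume, NOT a mass gap, NOT Clay).  Width seat `ym3-torus-px17` (gen 12).
THEOREMS ONLY (0 `def`, 0 `sorry`, default heartbeats); `--supports stmt-QuantumFields-19200 --as helper`; count-neutral.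

WHAT IS PROVED (ns `Summit.QuantumFields.YangMills.Theorems.Prop7H1GradientRowOfLetters`; member `F`, `h : n ≤ K`, weights `c₀ cB`, coupling `0 ≤ a`, ANY `T_J` letter `TJ`, `U₀ ∈ RegPr α`,
classes `hp₀` (slot `Δ^η`) and `hp₁` (slot `Δ₁`)).
* §1 `alpha_nonneg_of_regPr` (`0 ≤ α` read off `RegPr`), ★★ `gradient_row_GTone_of_letters_sup` — ✓p774384's (∇1) conclusion in the `(X, s)` currency of px21's `hGx`
  (`∀ X s, ‖X‖_∞ ≤ s → … ≤ BG₁·s`), under sign letters for the constants.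
* §2 ★★★ `gradient_row_HTone_of_letters` — N1-H's `hG` ∕ the 𝔊-door's `hHG` TEXT at `Δ₁`: `∀ b, ‖∇_{U₀}(toL2⁻¹(H₁(toL2B b)) ∘ bondEquiv⁻¹)‖ ≤ (BG₁·(CQ·CK))·‖b‖` from the (∇1) letters
  (V1)(Div1)(c1)(c2)(c3)(tJ)(tJd)(∇0)(H∇), the `Q_k†` sup row `hQa` and the `K₁⁻¹` sup row `hKinv` (✓`Prop7GreenPiGradientRowOfLetters.gradient_row_HT_of_gradient_row` ∘ §1).
* §3 ★★★ `norm_H1f_one_le_of_letters` — `norm_H₁`'s inequality `‖H1f … (DeltaOneP T_J) U₀ b‖ ≤ max M_V (BG₁·(CQ·CK))·‖b‖` from the VALUE letter `hV` of `H₁` (px21 ✓p772818-class, the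
  `h133(Δ₁)` kernel row summed) + §2's letters, through N1-H ✓`norm_H1f_apply_le_of_route_letters`.
* §4 ★★★ `norm_frakGfR_le_of_letters_of_valueH` — the 𝔊-door E2E (✓p774384 §3 `norm_frakGfR_le_of_letters`) with its `norm_H₁` text SUPPLIED by §3: `norm_G ⟸ (V1)(Div1)(c·)(tJ)(tJd)(Qrow)(∇0)(H∇)(Hess3) ∧ hV(H₁) ∧ hQa ∧ hKinv(Δ₁)`.
HYP-SAT (★★OWNER RULING №42): all letters are linear sup rows with named suppliers ((V1)∕(Div1) ✓p770606; (c·) px5 W4–W6 ✓; (tJ)(tJd) ✓p774572; (Qrow) ✓p773306; (∇0) ✓p774397; (H∇) ⧗p774613 ∘ (Dg) ⟸ hPcol;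
`hQa` ✓`norm_toL2_symm_adjoint_Qk_apply_le_of_regPr`; `hKinv(Δ₁)`-sup ⟸ the K-storey kernel row summed by ✓`sum_coarse_pbond_exp_neg_tdist_le`; `hV(H₁)` ⟸ ✓p772818 ∘ H-DOOR(Δ₁));
(Hess3) = STOREY H display.  Conclusions non-vacuous; no `Prop` placeholder.
HONEST SCOPE.  Bookkeeping; no estimate of print is proved here; nothing of the letters, `norm_H₁`, `norm_G`, the eight EX print rows, `hThm2S`, EX `stub_existenceMinimalOrbit`,
`MinimiserStabilityRegPr` (19200) or R3 is proved; the Yang–Mills mass gap is NOT proved.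

References: T. Bałaban, CMP **102** (1985) 277–309 [Balaban1985Variational] ((103) p.293, (110)–(111) p.294, (115)–(117) pp.294–295); CMP **99** (1985) 389–434
[Balaban1985BackgroundPropagators] ((3.126) p.420, (3.129) p.421, (3.138) p.423, (3.152)–(3.153) p.426, Thm 3.13 p.426).
-/

set_option autoImplicit false

noncomputable section

open scoped BigOperators Matrix.Norms.L2Operator InnerProductSpace ComplexConjugate

namespace Summit.QuantumFields.YangMills.Theorems.Prop7H1GradientRowOfLetters

open Literature.MathematicalPhysics.QuantumFieldTheory.Balaban1983to89
open Literature.MathematicalPhysics.QuantumFieldTheory.Balaban1983to89.T3ContinuumYM3Torus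
open T3PrintedRegularMinimiser (RegPr)
open T3SectALandauChart (eta eta_pos)
open B9SectCLatticeCarrier (Bond)
open B9Eq311L2Pairing (WL2)
open B11Eq115Space (NegSize Space115)
open B11Eq111FrakG (nabla115)
open B11Eq103H1Complex (SiteL2K BondL2K)
open Summit.QuantumFields.YangMills.Theorems.Prop7SectET3Transport (periodsT3 bondEquiv bgOfCfg)
open Summit.QuantumFields.YangMills.Theorems.Prop7SectET3HilbertLetters (W₂ toL2 toL2S toL2B DL2 DstarL2)
open Summit.QuantumFields.YangMills.Theorems.Prop7SectET3GaugeProjector (RS)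
open Summit.QuantumFields.YangMills.Theorems.Prop7SectET3WilsonHessian (DeltaEtaSlot)
open Summit.QuantumFields.YangMills.Theorems.Prop7SectET3CurvedPropagators (Qk PosOnto GT HT KinvT H1f frakGT frakGfR)
open Summit.QuantumFields.YangMills.Theorems.Prop7SectET3DeltaPiPInv (GprimeP)
open Summit.QuantumFields.YangMills.Theorems.Prop7SectET3DeltaOnePInv (DeltaOneP)
open Summit.QuantumFields.YangMills.Theorems.Prop7GreenOneGradientRowOfLetters (gradient_row_GTone_of_letters norm_frakGfR_le_of_letters)
open Summit.QuantumFields.YangMills.Theorems.Prop7GreenPiGradientRowOfLetters (gradient_row_HT_of_gradient_row)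
open Summit.QuantumFields.YangMills.Theorems.Prop7H1fNormOfSupLetters (norm_H1f_apply_le_of_route_letters)

variable {F : T3Family} {n K : ℕ} {h : n ≤ K} {c₀ cB a : ℝ} [Fact (0 < c₀)] [Fact (0 < cB)]
  (TJ : GaugeField (F.P K) 0 (Matrix.specialUnitaryGroup (Fin 2) ℂ) → (BondL2K ℂ 3 (periodsT3 F K) c₀ W₂ →ₗ[ℂ] BondL2K ℂ 3 (periodsT3 F K) c₀ W₂))

/-! ## §1 `0 ≤ α` on the regular class, and (∇1) in the `(X, s)` currency -/

omit [Fact (0 < c₀)] [Fact (0 < cB)] in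
/-- `0 ≤ α` whenever `RegPr F n K α U₀` (the (3.117) current bound `‖J₁‖ ≤ α·η³` at one bond). [cite: Balaban1985BackgroundPropagators, (3.117) p.419] -/
theorem alpha_nonneg_of_regPr {α : ℝ} (U₀ : GaugeField (F.P K) 0 (Matrix.specialUnitaryGroup (Fin 2) ℂ)) (hreg : RegPr F n K α U₀) : 0 ≤ α := by
  have hη : 0 < eta F n K := eta_pos F n K
  have hJ := Prop7DeltaPiDefectPairing.norm_J_one_le_of_regPr U₀ hreg 0 (Classical.arbitrary _)
  have h0 : 0 * eta F n K ^ 3 ≤ α * eta F n K ^ 3 := by rw [zero_mul]; exact (norm_nonneg _).trans hJ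
  exact le_of_mul_le_mul_right h0 (pow_pos hη 3)

/-- ★★ **(∇1) IN THE `(X, s)` CURRENCY** (the `hGx` shape of ✓`gradient_row_HT_of_gradient_row`): ✓p774384 `gradient_row_GTone_of_letters` read with `‖X‖ ≤ s` (`pi_norm_le_iff`) and the
constants' signs. [cite: Balaban1985BackgroundPropagators, (3.138) p.423, Thm 3.13 p.426; Balaban1985Variational, (115)–(117) pp.294–295] -/
theorem gradient_row_GTone_of_letters_sup {α : ℝ} (U₀ : GaugeField (F.P K) 0 (Matrix.specialUnitaryGroup (Fin 2) ℂ)) (hreg : RegPr F n K α U₀) (ha : 0 ≤ a)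
    (hp₀ : PosOnto F n K h c₀ cB a (DeltaEtaSlot F n K c₀) U₀) (hp₁ : PosOnto F n K h c₀ cB a (DeltaOneP F n K h c₀ cB a TJ) U₀)
    {BV₁ BD₁ C₁ C₂ C₃ CT CTD BG BH : ℝ} (hBV₁ : 0 ≤ BV₁) (hBD₁ : 0 ≤ BD₁) (hC₁ : 0 ≤ C₁) (hC₂ : 0 ≤ C₂) (hC₃ : 0 ≤ C₃) (hCT : 0 ≤ CT) (hCTD : 0 ≤ CTD)
    (hBG : 0 ≤ BG) (hBH : 0 ≤ BH)
    (hV1 : ∀ (A : PBond (F.P K) 0 → Matrix (Fin 2) (Fin 2) ℂ) (b : PBond (F.P K) 0),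
      ‖(toL2 F K c₀).symm (GT F n K h c₀ cB a (DeltaOneP F n K h c₀ cB a TJ) U₀ (toL2 F K c₀ A)) b‖ ≤ BV₁ * ‖A‖)
    (hD1 : ∀ (A : PBond (F.P K) 0 → Matrix (Fin 2) (Fin 2) ℂ) (x : Site (F.P K) 0),
      ‖(toL2S F K c₀).symm (DstarL2 F n K c₀ U₀ (GT F n K h c₀ cB a (DeltaOneP F n K h c₀ cB a TJ) U₀ (toL2 F K c₀ A))) x‖ ≤ BD₁ * ‖A‖)
    (hc1 : ∀ (v : Site (F.P K) 0 → Matrix (Fin 2) (Fin 2) ℂ) (m : ℝ), (∀ x, ‖v x‖ ≤ m) →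
      ∀ x, ‖(toL2S F K c₀).symm (GprimeP F n K h c₀ cB a U₀ (RS F n K h c₀ cB U₀ (toL2S F K c₀ v))) x‖ ≤ C₁ * m)
    (hc2 : ∀ (v : Site (F.P K) 0 → Matrix (Fin 2) (Fin 2) ℂ) (m : ℝ), (∀ x, ‖v x‖ ≤ m) →
      ∀ b, ‖(toL2 F K c₀).symm (DL2 F n K c₀ U₀ (GprimeP F n K h c₀ cB a U₀ (RS F n K h c₀ cB U₀ (toL2S F K c₀ v)))) b‖ ≤ C₂ * m)
    (hc3 : ∀ (v : Site (F.P K) 0 → Matrix (Fin 2) (Fin 2) ℂ) (m : ℝ), (∀ x, ‖v x‖ ≤ m) →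
      ∀ x, ‖(toL2S F K c₀).symm (RS F n K h c₀ cB U₀ (GprimeP F n K h c₀ cB a U₀ (toL2S F K c₀ v))) x‖ ≤ C₃ * m)
    (hTJ : ∀ (Y : PBond (F.P K) 0 → Matrix (Fin 2) (Fin 2) ℂ) (s : ℝ), (∀ b, ‖Y b‖ ≤ s) →
      ∀ b, ‖(toL2 F K c₀).symm (TJ U₀ (toL2 F K c₀ Y)) b‖ ≤ CT * s)
    (hTJd : ∀ (Y : PBond (F.P K) 0 → Matrix (Fin 2) (Fin 2) ℂ) (s : ℝ), (∀ b, ‖Y b‖ ≤ s) →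
      ∀ x, ‖(toL2S F K c₀).symm (DstarL2 F n K c₀ U₀ (TJ U₀ (toL2 F K c₀ Y))) x‖ ≤ CTD * s)
    (hG0 : ∀ (X : PBond (F.P K) 0 → Matrix (Fin 2) (Fin 2) ℂ) (s : ℝ), (∀ b, ‖X b‖ ≤ s) →
      ‖nabla115 (((F.L : ℝ)⁻¹) ^ (K - n)) (bgOfCfg F K U₀)
          (fun q : Bond 3 (periodsT3 F K) => (toL2 F K c₀).symm (GT F n K h c₀ cB a (DeltaEtaSlot F n K c₀) U₀ (toL2 F K c₀ X)) ((bondEquiv F K).symm q))‖ ≤ BG * s)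
    (hHD : ∀ (v : Site (F.P K) 0 → Matrix (Fin 2) (Fin 2) ℂ) (m : ℝ), (∀ x, ‖v x‖ ≤ m) →
      ‖nabla115 (((F.L : ℝ)⁻¹) ^ (K - n)) (bgOfCfg F K U₀)
          (fun q : Bond 3 (periodsT3 F K) => (toL2 F K c₀).symm (DL2 F n K c₀ U₀ (GprimeP F n K h c₀ cB a U₀ (RS F n K h c₀ cB U₀
            (GprimeP F n K h c₀ cB a U₀ (toL2S F K c₀ v))))) ((bondEquiv F K).symm q))‖ ≤ BH * m) :
    ∀ (X : PBond (F.P K) 0 → Matrix (Fin 2) (Fin 2) ℂ) (s : ℝ), (∀ b, ‖X b‖ ≤ s) →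
      ‖nabla115 (((F.L : ℝ)⁻¹) ^ (K - n)) (bgOfCfg F K U₀)
          (fun q : Bond 3 (periodsT3 F K) => (toL2 F K c₀).symm (GT F n K h c₀ cB a (DeltaOneP F n K h c₀ cB a TJ) U₀ (toL2 F K c₀ X)) ((bondEquiv F K).symm q))‖
        ≤ (BG * (1 + 4 * α * C₁ * BD₁ + (4 * α * C₁ * C₃ * (12 * α + CTD) + CT) * (BV₁ + C₂ * BD₁))
            + BH * (12 * α + CTD) * (BV₁ + C₂ * BD₁)) * s := by
  intro X s hX
  have hs : 0 ≤ s := (norm_nonneg _).trans (hX ⟨Classical.arbitrary _, 0⟩)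
  have hα : 0 ≤ α := alpha_nonneg_of_regPr U₀ hreg
  have hXs : ‖X‖ ≤ s := (pi_norm_le_iff_of_nonneg hs).2 hX
  have hrow := gradient_row_GTone_of_letters TJ U₀ hreg ha hp₀ hp₁ hV1 hD1 hc1 hc2 hc3 hTJ hTJd hG0 hHD X
  have hB : 0 ≤ (BG * (1 + 4 * α * C₁ * BD₁ + (4 * α * C₁ * C₃ * (12 * α + CTD) + CT) * (BV₁ + C₂ * BD₁))
            + BH * (12 * α + CTD) * (BV₁ + C₂ * BD₁)) := by positivity
  exact hrow.trans (mul_le_mul_of_nonneg_left hXs hB)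

/-! ## §2 ★★★ The gradient row of `H₁ = G₁Q_k†K₁⁻¹` — census row (6)'s ∇-half -/

/-- ★★★ **THE (115)-GRADIENT LETTER OF `norm_H₁` FROM LETTERS** (N1-H ✓p768666's `hG` binder ∕ the 𝔊-door ✓p769750's `hHG` binder TEXT at `Δx := Δ₁ = DeltaOneP … a T_J`): on the classes,
from the (∇1) letters, the `Q_k†` sup row `hQa` (`0 ≤ CQ`) and the `K₁⁻¹` sup row `hKinv`,
`∀ b, ‖∇_{U₀}(toL2⁻¹(H₁(toL2B b)) ∘ bondEquiv⁻¹)‖ ≤ (BG₁·(CQ·CK))·‖b‖`, `BG₁` = ✓p774384's constant — px21 g15's slot-generic ✓`gradient_row_HT_of_gradient_row` ∘ §1.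
[cite: Balaban1985Variational, (103) p.293, (115) p.294; Balaban1985BackgroundPropagators, (3.129) p.421, (3.138) p.423] -/
theorem gradient_row_HTone_of_letters {α : ℝ} (U₀ : GaugeField (F.P K) 0 (Matrix.specialUnitaryGroup (Fin 2) ℂ)) (hreg : RegPr F n K α U₀) (ha : 0 ≤ a)
    (hp₀ : PosOnto F n K h c₀ cB a (DeltaEtaSlot F n K c₀) U₀) (hp₁ : PosOnto F n K h c₀ cB a (DeltaOneP F n K h c₀ cB a TJ) U₀)
    {BV₁ BD₁ C₁ C₂ C₃ CT CTD BG BH CQ CK : ℝ} (hBV₁ : 0 ≤ BV₁) (hBD₁ : 0 ≤ BD₁) (hC₁ : 0 ≤ C₁) (hC₂ : 0 ≤ C₂) (hC₃ : 0 ≤ C₃) (hCT : 0 ≤ CT) (hCTD : 0 ≤ CTD)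
    (hBG : 0 ≤ BG) (hBH : 0 ≤ BH) (hCQ : 0 ≤ CQ)
    (hV1 : ∀ (A : PBond (F.P K) 0 → Matrix (Fin 2) (Fin 2) ℂ) (b : PBond (F.P K) 0),
      ‖(toL2 F K c₀).symm (GT F n K h c₀ cB a (DeltaOneP F n K h c₀ cB a TJ) U₀ (toL2 F K c₀ A)) b‖ ≤ BV₁ * ‖A‖)
    (hD1 : ∀ (A : PBond (F.P K) 0 → Matrix (Fin 2) (Fin 2) ℂ) (x : Site (F.P K) 0),
      ‖(toL2S F K c₀).symm (DstarL2 F n K c₀ U₀ (GT F n K h c₀ cB a (DeltaOneP F n K h c₀ cB a TJ) U₀ (toL2 F K c₀ A))) x‖ ≤ BD₁ * ‖A‖)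
    (hc1 : ∀ (v : Site (F.P K) 0 → Matrix (Fin 2) (Fin 2) ℂ) (m : ℝ), (∀ x, ‖v x‖ ≤ m) →
      ∀ x, ‖(toL2S F K c₀).symm (GprimeP F n K h c₀ cB a U₀ (RS F n K h c₀ cB U₀ (toL2S F K c₀ v))) x‖ ≤ C₁ * m)
    (hc2 : ∀ (v : Site (F.P K) 0 → Matrix (Fin 2) (Fin 2) ℂ) (m : ℝ), (∀ x, ‖v x‖ ≤ m) →
      ∀ b, ‖(toL2 F K c₀).symm (DL2 F n K c₀ U₀ (GprimeP F n K h c₀ cB a U₀ (RS F n K h c₀ cB U₀ (toL2S F K c₀ v)))) b‖ ≤ C₂ * m)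
    (hc3 : ∀ (v : Site (F.P K) 0 → Matrix (Fin 2) (Fin 2) ℂ) (m : ℝ), (∀ x, ‖v x‖ ≤ m) →
      ∀ x, ‖(toL2S F K c₀).symm (RS F n K h c₀ cB U₀ (GprimeP F n K h c₀ cB a U₀ (toL2S F K c₀ v))) x‖ ≤ C₃ * m)
    (hTJ : ∀ (Y : PBond (F.P K) 0 → Matrix (Fin 2) (Fin 2) ℂ) (s : ℝ), (∀ b, ‖Y b‖ ≤ s) →
      ∀ b, ‖(toL2 F K c₀).symm (TJ U₀ (toL2 F K c₀ Y)) b‖ ≤ CT * s)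
    (hTJd : ∀ (Y : PBond (F.P K) 0 → Matrix (Fin 2) (Fin 2) ℂ) (s : ℝ), (∀ b, ‖Y b‖ ≤ s) →
      ∀ x, ‖(toL2S F K c₀).symm (DstarL2 F n K c₀ U₀ (TJ U₀ (toL2 F K c₀ Y))) x‖ ≤ CTD * s)
    (hG0 : ∀ (X : PBond (F.P K) 0 → Matrix (Fin 2) (Fin 2) ℂ) (s : ℝ), (∀ b, ‖X b‖ ≤ s) →
      ‖nabla115 (((F.L : ℝ)⁻¹) ^ (K - n)) (bgOfCfg F K U₀)
          (fun q : Bond 3 (periodsT3 F K) => (toL2 F K c₀).symm (GT F n K h c₀ cB a (DeltaEtaSlot F n K c₀) U₀ (toL2 F K c₀ X)) ((bondEquiv F K).symm q))‖ ≤ BG * s)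
    (hHD : ∀ (v : Site (F.P K) 0 → Matrix (Fin 2) (Fin 2) ℂ) (m : ℝ), (∀ x, ‖v x‖ ≤ m) →
      ‖nabla115 (((F.L : ℝ)⁻¹) ^ (K - n)) (bgOfCfg F K U₀)
          (fun q : Bond 3 (periodsT3 F K) => (toL2 F K c₀).symm (DL2 F n K c₀ U₀ (GprimeP F n K h c₀ cB a U₀ (RS F n K h c₀ cB U₀
            (GprimeP F n K h c₀ cB a U₀ (toL2S F K c₀ v))))) ((bondEquiv F K).symm q))‖ ≤ BH * m)
    (hQa : ∀ (Y : PBond (F.P n) 0 → Matrix (Fin 2) (Fin 2) ℂ) (bd : PBond (F.P K) 0),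
      ‖(toL2 F K c₀).symm (LinearMap.adjoint (Qk F n K h c₀ cB U₀) (toL2B F n cB Y)) bd‖ ≤ CQ * ‖Y‖)
    (hKinv : ∀ (b : PBond (F.P n) 0 → Matrix (Fin 2) (Fin 2) ℂ) (c : PBond (F.P n) 0),
      ‖(toL2B F n cB).symm (KinvT F n K h c₀ cB a (DeltaOneP F n K h c₀ cB a TJ) U₀ (toL2B F n cB b)) c‖ ≤ CK * ‖b‖)
    (b : PBond (F.P n) 0 → Matrix (Fin 2) (Fin 2) ℂ) :
    ‖nabla115 (((F.L : ℝ)⁻¹) ^ (K - n)) (bgOfCfg F K U₀)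
        (fun q : Bond 3 (periodsT3 F K) => (toL2 F K c₀).symm (HT F n K h c₀ cB a (DeltaOneP F n K h c₀ cB a TJ) U₀ (toL2B F n cB b)) ((bondEquiv F K).symm q))‖
      ≤ ((BG * (1 + 4 * α * C₁ * BD₁ + (4 * α * C₁ * C₃ * (12 * α + CTD) + CT) * (BV₁ + C₂ * BD₁))
            + BH * (12 * α + CTD) * (BV₁ + C₂ * BD₁)) * (CQ * CK)) * ‖b‖ :=
  gradient_row_HT_of_gradient_row U₀ (DeltaOneP F n K h c₀ cB a TJ) hp₁ hCQ
    (gradient_row_GTone_of_letters_sup TJ U₀ hreg ha hp₀ hp₁ hBV₁ hBD₁ hC₁ hC₂ hC₃ hCT hCTD hBG hBH hV1 hD1 hc1 hc2 hc3 hTJ hTJd hG0 hHD) hQa hKinv b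

/-! ## §3 ★★★ `norm_H₁` from its VALUE letter and the gradient letters -/

section H1

variable [Fact (0 < (F.L : ℝ))] [Fact (0 < ((F.L : ℝ)⁻¹) ^ (K - n))]

/-- ★★★ **`norm_H₁`'S INEQUALITY FROM LETTERS** (census row (6)): the VALUE letter `hV` of `H₁` (bondwise, `M_V`; ✓p772818-class) and §2's letters give
`‖H1f … (DeltaOneP T_J) U₀ b‖ ≤ max M_V (BG₁·(CQ·CK))·‖b‖` — N1-H ✓`norm_H1f_apply_le_of_route_letters` at `Δ₁` with its `hG` letter DISCHARGED by §2.
[cite: Balaban1985Variational, (103) p.293, (117) p.295; Balaban1985BackgroundPropagators, (3.129) p.421, Thm 3.13 p.426] -/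
theorem norm_H1f_one_le_of_letters {α : ℝ} (U₀ : GaugeField (F.P K) 0 (Matrix.specialUnitaryGroup (Fin 2) ℂ)) (hreg : RegPr F n K α U₀) (ha : 0 ≤ a)
    (hp₀ : PosOnto F n K h c₀ cB a (DeltaEtaSlot F n K c₀) U₀) (hp₁ : PosOnto F n K h c₀ cB a (DeltaOneP F n K h c₀ cB a TJ) U₀)
    {BV₁ BD₁ C₁ C₂ C₃ CT CTD BG BH CQ CK MV : ℝ} (hBV₁ : 0 ≤ BV₁) (hBD₁ : 0 ≤ BD₁) (hC₁ : 0 ≤ C₁) (hC₂ : 0 ≤ C₂) (hC₃ : 0 ≤ C₃) (hCT : 0 ≤ CT) (hCTD : 0 ≤ CTD)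
    (hBG : 0 ≤ BG) (hBH : 0 ≤ BH) (hCQ : 0 ≤ CQ) (hMV : 0 ≤ MV)
    (hV1 : ∀ (A : PBond (F.P K) 0 → Matrix (Fin 2) (Fin 2) ℂ) (b : PBond (F.P K) 0),
      ‖(toL2 F K c₀).symm (GT F n K h c₀ cB a (DeltaOneP F n K h c₀ cB a TJ) U₀ (toL2 F K c₀ A)) b‖ ≤ BV₁ * ‖A‖)
    (hD1 : ∀ (A : PBond (F.P K) 0 → Matrix (Fin 2) (Fin 2) ℂ) (x : Site (F.P K) 0),
      ‖(toL2S F K c₀).symm (DstarL2 F n K c₀ U₀ (GT F n K h c₀ cB a (DeltaOneP F n K h c₀ cB a TJ) U₀ (toL2 F K c₀ A))) x‖ ≤ BD₁ * ‖A‖)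
    (hc1 : ∀ (v : Site (F.P K) 0 → Matrix (Fin 2) (Fin 2) ℂ) (m : ℝ), (∀ x, ‖v x‖ ≤ m) →
      ∀ x, ‖(toL2S F K c₀).symm (GprimeP F n K h c₀ cB a U₀ (RS F n K h c₀ cB U₀ (toL2S F K c₀ v))) x‖ ≤ C₁ * m)
    (hc2 : ∀ (v : Site (F.P K) 0 → Matrix (Fin 2) (Fin 2) ℂ) (m : ℝ), (∀ x, ‖v x‖ ≤ m) →
      ∀ b, ‖(toL2 F K c₀).symm (DL2 F n K c₀ U₀ (GprimeP F n K h c₀ cB a U₀ (RS F n K h c₀ cB U₀ (toL2S F K c₀ v)))) b‖ ≤ C₂ * m)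
    (hc3 : ∀ (v : Site (F.P K) 0 → Matrix (Fin 2) (Fin 2) ℂ) (m : ℝ), (∀ x, ‖v x‖ ≤ m) →
      ∀ x, ‖(toL2S F K c₀).symm (RS F n K h c₀ cB U₀ (GprimeP F n K h c₀ cB a U₀ (toL2S F K c₀ v))) x‖ ≤ C₃ * m)
    (hTJ : ∀ (Y : PBond (F.P K) 0 → Matrix (Fin 2) (Fin 2) ℂ) (s : ℝ), (∀ b, ‖Y b‖ ≤ s) →
      ∀ b, ‖(toL2 F K c₀).symm (TJ U₀ (toL2 F K c₀ Y)) b‖ ≤ CT * s)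
    (hTJd : ∀ (Y : PBond (F.P K) 0 → Matrix (Fin 2) (Fin 2) ℂ) (s : ℝ), (∀ b, ‖Y b‖ ≤ s) →
      ∀ x, ‖(toL2S F K c₀).symm (DstarL2 F n K c₀ U₀ (TJ U₀ (toL2 F K c₀ Y))) x‖ ≤ CTD * s)
    (hG0 : ∀ (X : PBond (F.P K) 0 → Matrix (Fin 2) (Fin 2) ℂ) (s : ℝ), (∀ b, ‖X b‖ ≤ s) →
      ‖nabla115 (((F.L : ℝ)⁻¹) ^ (K - n)) (bgOfCfg F K U₀)
          (fun q : Bond 3 (periodsT3 F K) => (toL2 F K c₀).symm (GT F n K h c₀ cB a (DeltaEtaSlot F n K c₀) U₀ (toL2 F K c₀ X)) ((bondEquiv F K).symm q))‖ ≤ BG * s)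
    (hHD : ∀ (v : Site (F.P K) 0 → Matrix (Fin 2) (Fin 2) ℂ) (m : ℝ), (∀ x, ‖v x‖ ≤ m) →
      ‖nabla115 (((F.L : ℝ)⁻¹) ^ (K - n)) (bgOfCfg F K U₀)
          (fun q : Bond 3 (periodsT3 F K) => (toL2 F K c₀).symm (DL2 F n K c₀ U₀ (GprimeP F n K h c₀ cB a U₀ (RS F n K h c₀ cB U₀
            (GprimeP F n K h c₀ cB a U₀ (toL2S F K c₀ v))))) ((bondEquiv F K).symm q))‖ ≤ BH * m)
    (hQa : ∀ (Y : PBond (F.P n) 0 → Matrix (Fin 2) (Fin 2) ℂ) (bd : PBond (F.P K) 0),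
      ‖(toL2 F K c₀).symm (LinearMap.adjoint (Qk F n K h c₀ cB U₀) (toL2B F n cB Y)) bd‖ ≤ CQ * ‖Y‖)
    (hKinv : ∀ (b : PBond (F.P n) 0 → Matrix (Fin 2) (Fin 2) ℂ) (c : PBond (F.P n) 0),
      ‖(toL2B F n cB).symm (KinvT F n K h c₀ cB a (DeltaOneP F n K h c₀ cB a TJ) U₀ (toL2B F n cB b)) c‖ ≤ CK * ‖b‖)
    (hV : ∀ (b : PBond (F.P n) 0 → Matrix (Fin 2) (Fin 2) ℂ) (bd : PBond (F.P K) 0),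
      ‖(toL2 F K c₀).symm (HT F n K h c₀ cB a (DeltaOneP F n K h c₀ cB a TJ) U₀ (toL2B F n cB b)) bd‖ ≤ MV * ‖b‖)
    (b : PBond (F.P n) 0 → Matrix (Fin 2) (Fin 2) ℂ) :
    ‖H1f F n K h c₀ cB a (DeltaOneP F n K h c₀ cB a TJ) U₀ b‖
      ≤ max MV ((BG * (1 + 4 * α * C₁ * BD₁ + (4 * α * C₁ * C₃ * (12 * α + CTD) + CT) * (BV₁ + C₂ * BD₁))
            + BH * (12 * α + CTD) * (BV₁ + C₂ * BD₁)) * (CQ * CK)) * ‖b‖ :=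
  norm_H1f_apply_le_of_route_letters F n K h c₀ cB a (DeltaOneP F n K h c₀ cB a TJ) U₀ hMV hV
    (gradient_row_HTone_of_letters TJ U₀ hreg ha hp₀ hp₁ hBV₁ hBD₁ hC₁ hC₂ hC₃ hCT hCTD hBG hBH hCQ hV1 hD1 hc1 hc2 hc3 hTJ hTJd hG0 hHD hQa hKinv) b

/-! ## §4 ★★★ `norm_G` with the `norm_H₁` text supplied by §3 -/

/-- ★★★ **`norm_G`'s INEQUALITY WITH `hG1`, `hHG` AND THE `norm_H₁` TEXT ALL DISCHARGED** (✓p774384 `norm_frakGfR_le_of_letters` ∘ §3): at the slot `Δ₁ = Pᴾ†(Δ^η + T_J)Pᴾ`,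
`‖frakGfR … (DeltaOneP T_J) U₀ f‖ ≤ max M_V′ M_∇′ · ‖f‖` from the word letters (V1)(Div1)(c1)(c2)(c3)(tJ)(tJd)(Qrow)(∇0)(H∇), ONE displayed gradient letter (Hess3), the VALUE letter `hV`
of `H₁`, the `Q_k†` sup row and the `K₁⁻¹` sup row — with `B_H := max M_V (BG₁·(CQ·CK))`. [cite: Balaban1985Variational, (117) p.295; Balaban1985BackgroundPropagators, Thm 3.13 p.426, (3.152)–(3.153) p.426] -/
theorem norm_frakGfR_le_of_letters_of_valueH {α : ℝ} (U₀ : GaugeField (F.P K) 0 (Matrix.specialUnitaryGroup (Fin 2) ℂ)) (hreg : RegPr F n K α U₀) (ha : 0 ≤ a)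
    (hp₀ : PosOnto F n K h c₀ cB a (DeltaEtaSlot F n K c₀) U₀) (hp₁ : PosOnto F n K h c₀ cB a (DeltaOneP F n K h c₀ cB a TJ) U₀)
    {BV₁ BD₁ C₁ C₂ C₃ CT CTD BG BH CQ CK MV BQ M₃ : ℝ} (hBV₁ : 0 ≤ BV₁) (hBD₁ : 0 ≤ BD₁) (hC₁ : 0 ≤ C₁) (hC₂ : 0 ≤ C₂) (hC₃ : 0 ≤ C₃) (hCT : 0 ≤ CT) (hCTD : 0 ≤ CTD)
    (hBG : 0 ≤ BG) (hBH : 0 ≤ BH) (hCQ : 0 ≤ CQ) (hMV : 0 ≤ MV) (hBQ : 0 ≤ BQ)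
    (hV1 : ∀ (A : PBond (F.P K) 0 → Matrix (Fin 2) (Fin 2) ℂ) (b : PBond (F.P K) 0),
      ‖(toL2 F K c₀).symm (GT F n K h c₀ cB a (DeltaOneP F n K h c₀ cB a TJ) U₀ (toL2 F K c₀ A)) b‖ ≤ BV₁ * ‖A‖)
    (hD1 : ∀ (A : PBond (F.P K) 0 → Matrix (Fin 2) (Fin 2) ℂ) (x : Site (F.P K) 0),
      ‖(toL2S F K c₀).symm (DstarL2 F n K c₀ U₀ (GT F n K h c₀ cB a (DeltaOneP F n K h c₀ cB a TJ) U₀ (toL2 F K c₀ A))) x‖ ≤ BD₁ * ‖A‖)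
    (hc1 : ∀ (v : Site (F.P K) 0 → Matrix (Fin 2) (Fin 2) ℂ) (m : ℝ), (∀ x, ‖v x‖ ≤ m) →
      ∀ x, ‖(toL2S F K c₀).symm (GprimeP F n K h c₀ cB a U₀ (RS F n K h c₀ cB U₀ (toL2S F K c₀ v))) x‖ ≤ C₁ * m)
    (hc2 : ∀ (v : Site (F.P K) 0 → Matrix (Fin 2) (Fin 2) ℂ) (m : ℝ), (∀ x, ‖v x‖ ≤ m) →
      ∀ b, ‖(toL2 F K c₀).symm (DL2 F n K c₀ U₀ (GprimeP F n K h c₀ cB a U₀ (RS F n K h c₀ cB U₀ (toL2S F K c₀ v)))) b‖ ≤ C₂ * m)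
    (hc3 : ∀ (v : Site (F.P K) 0 → Matrix (Fin 2) (Fin 2) ℂ) (m : ℝ), (∀ x, ‖v x‖ ≤ m) →
      ∀ x, ‖(toL2S F K c₀).symm (RS F n K h c₀ cB U₀ (GprimeP F n K h c₀ cB a U₀ (toL2S F K c₀ v))) x‖ ≤ C₃ * m)
    (hTJ : ∀ (Y : PBond (F.P K) 0 → Matrix (Fin 2) (Fin 2) ℂ) (s : ℝ), (∀ b, ‖Y b‖ ≤ s) →
      ∀ b, ‖(toL2 F K c₀).symm (TJ U₀ (toL2 F K c₀ Y)) b‖ ≤ CT * s)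
    (hTJd : ∀ (Y : PBond (F.P K) 0 → Matrix (Fin 2) (Fin 2) ℂ) (s : ℝ), (∀ b, ‖Y b‖ ≤ s) →
      ∀ x, ‖(toL2S F K c₀).symm (DstarL2 F n K c₀ U₀ (TJ U₀ (toL2 F K c₀ Y))) x‖ ≤ CTD * s)
    (hQ : ∀ (u : BondL2K ℂ 3 (periodsT3 F K) c₀ W₂) (s : ℝ), (∀ b, ‖(toL2 F K c₀).symm u b‖ ≤ s) →
      ∀ c, ‖(toL2B F n cB).symm (Qk F n K h c₀ cB U₀ u) c‖ ≤ BQ * s)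
    (hG0 : ∀ (X : PBond (F.P K) 0 → Matrix (Fin 2) (Fin 2) ℂ) (s : ℝ), (∀ b, ‖X b‖ ≤ s) →
      ‖nabla115 (((F.L : ℝ)⁻¹) ^ (K - n)) (bgOfCfg F K U₀)
          (fun q : Bond 3 (periodsT3 F K) => (toL2 F K c₀).symm (GT F n K h c₀ cB a (DeltaEtaSlot F n K c₀) U₀ (toL2 F K c₀ X)) ((bondEquiv F K).symm q))‖ ≤ BG * s)
    (hHD : ∀ (v : Site (F.P K) 0 → Matrix (Fin 2) (Fin 2) ℂ) (m : ℝ), (∀ x, ‖v x‖ ≤ m) →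
      ‖nabla115 (((F.L : ℝ)⁻¹) ^ (K - n)) (bgOfCfg F K U₀)
          (fun q : Bond 3 (periodsT3 F K) => (toL2 F K c₀).symm (DL2 F n K c₀ U₀ (GprimeP F n K h c₀ cB a U₀ (RS F n K h c₀ cB U₀
            (GprimeP F n K h c₀ cB a U₀ (toL2S F K c₀ v))))) ((bondEquiv F K).symm q))‖ ≤ BH * m)
    (h3 : ∀ A : PBond (F.P K) 0 → Matrix (Fin 2) (Fin 2) ℂ,
      ‖nabla115 (((F.L : ℝ)⁻¹) ^ (K - n)) (bgOfCfg F K U₀)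
          (fun q : Bond 3 (periodsT3 F K) => (toL2 F K c₀).symm (DL2 F n K c₀ U₀ (GprimeP F n K h c₀ cB a U₀ (RS F n K h c₀ cB U₀
            (DstarL2 F n K c₀ U₀ (GT F n K h c₀ cB a (DeltaOneP F n K h c₀ cB a TJ) U₀ (toL2 F K c₀ A)))))) ((bondEquiv F K).symm q))‖ ≤ M₃ * ‖A‖)
    (hQa : ∀ (Y : PBond (F.P n) 0 → Matrix (Fin 2) (Fin 2) ℂ) (bd : PBond (F.P K) 0),
      ‖(toL2 F K c₀).symm (LinearMap.adjoint (Qk F n K h c₀ cB U₀) (toL2B F n cB Y)) bd‖ ≤ CQ * ‖Y‖)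
    (hKinv : ∀ (b : PBond (F.P n) 0 → Matrix (Fin 2) (Fin 2) ℂ) (c : PBond (F.P n) 0),
      ‖(toL2B F n cB).symm (KinvT F n K h c₀ cB a (DeltaOneP F n K h c₀ cB a TJ) U₀ (toL2B F n cB b)) c‖ ≤ CK * ‖b‖)
    (hV : ∀ (b : PBond (F.P n) 0 → Matrix (Fin 2) (Fin 2) ℂ) (bd : PBond (F.P K) 0),
      ‖(toL2 F K c₀).symm (HT F n K h c₀ cB a (DeltaOneP F n K h c₀ cB a TJ) U₀ (toL2B F n cB b)) bd‖ ≤ MV * ‖b‖)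
    (f : NegSize (F.L : ℝ) (((F.L : ℝ)⁻¹) ^ (K - n)) (fun _ : Bond 3 (periodsT3 F K) => K - n) 3 (Matrix (Fin 2) (Fin 2) ℂ)) :
    ‖frakGfR F n K h c₀ cB a (DeltaOneP F n K h c₀ cB a TJ) U₀ f‖
      ≤ max (BV₁ + C₂ * BD₁ + (max MV ((BG * (1 + 4 * α * C₁ * BD₁ + (4 * α * C₁ * C₃ * (12 * α + CTD) + CT) * (BV₁ + C₂ * BD₁))
            + BH * (12 * α + CTD) * (BV₁ + C₂ * BD₁)) * (CQ * CK))) * BQ * BV₁)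
          ((BG * (1 + 4 * α * C₁ * BD₁ + (4 * α * C₁ * C₃ * (12 * α + CTD) + CT) * (BV₁ + C₂ * BD₁))
            + BH * (12 * α + CTD) * (BV₁ + C₂ * BD₁)) + M₃ + (max MV ((BG * (1 + 4 * α * C₁ * BD₁ + (4 * α * C₁ * C₃ * (12 * α + CTD) + CT) * (BV₁ + C₂ * BD₁))
            + BH * (12 * α + CTD) * (BV₁ + C₂ * BD₁)) * (CQ * CK))) * BQ * BV₁) * ‖f‖ :=
  norm_frakGfR_le_of_letters TJ U₀ hreg ha hp₀ hp₁ hBV₁ hBD₁ hC₂ (le_max_of_le_left hMV) hBQ hV1 hD1 hc1 hc2 hc3 hTJ hTJd hQ hG0 hHD h3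
    (norm_H1f_one_le_of_letters TJ U₀ hreg ha hp₀ hp₁ hBV₁ hBD₁ hC₁ hC₂ hC₃ hCT hCTD hBG hBH hCQ hMV hV1 hD1 hc1 hc2 hc3 hTJ hTJd hG0 hHD hQa hKinv hV) f

end H1

end Summit.QuantumFields.YangMills.Theorems.Prop7H1GradientRowOfLetters

end
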